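import Summits.BirchSwinnertonDyer.Rank1Residual.X5.KatoOrdTwoMuPart
import Summits.BirchSwinnertonDyer.Rank1Residual.X2.IsogenyLineTypeGoodOrdinary
import Summits.BirchSwinnertonDyer.BirchSwinnertonDyer.Theorems.ByReductionTypeAtTwoOrdKatoIntDefs
import Literature.NumberTheory.EllipticCurves.IsogenyIdProofs
import HarnessLib

/-!
# Route ByReductionTypeAtTwo, crux `OrdKatoHalfAtTwoIso` (stmt-BirchSwinnertonDyer-19573), stub
# `stub_nonsurj_iso`: the DISPLAYED binder «Kato half at the Kato-optimal member for curves with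
# non-surjective `ρ̄_{E,2}`» (cell MEMO-7, «Wuthrich-at-2») and its PROVED doors

Seat `bsd-2adic-ord` GEN 10 (HOME `run/shared/lean/pub/bsd-2adic/`, MEMO-7 FROZEN @03fe385917e0b426).
Theses-free module in the pattern of `ByReductionTypeAtTwoOrdKatoIntDefs.lean` (GEN 8) and
`ByReductionTypeAtTwoOrdKatoReserveDefs.lean` (GEN 9): two `@[conjecture]` constants + PROVED bookkeeping;
nothing asserted.

* `KatoMuPartAtOptimalMemberOfNotSurjectiveTwo` — **[crux, CELL-MEMO] MEMO-7 Theorem D + Theorem D-C₃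
  in the tree's `μ`-part currency**: for every non-CM globally minimal `W/ℚ`, good ordinary at `2`, whose
  mod-`2` representation is NOT surjective (`E[2]` reducible, or image `C₃`), there is a `ℚ`-isogenous
  globally minimal `W′` — the KATO-OPTIMAL member, whose `2`-adic Tate module realises Kato's lattice
  `V_{ℤ₂}(f)(1)` (it exists and is unique up to odd isogeny) — with (a) `O1.KatoMuPartAtTwo W′`
  (`μ(X(E′/ℚ_∞)) ≤ μ(ϖ_{E′}·L₂(f,α))`, BSD-period normalisation) and (b) Néron integrality at `W′`
  (`ϖ_{E′}·L₂(f,α) ∈ Λ`). Proof (memo grade): the Euler-system-FREE `Λ`-adic bookkeeping of the prior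
  programme's route `adjoint-selmer-patching` §6 (UPHELD 2026-08-08) read at `E′` (where Kato's Thm. 12.6
  applies with no homothety), plus Conjecture A at `2` and its relaxed-at-`∞` form for `E[2]`-reducible /
  `C₃` curves from Weber's theorem and Ferrero–Washington. NOT in print at `p = 2` (Wuthrich 2014 Thm. 16
  is the `p`-odd statement). Nothing asserted.
* `OrdKatoHalfDD12ResidueTwo` — **[crux, OPEN] the honest `∀`-residue of the crux after MEMO-7**: the Kato
  half AT `W` for good-ordinary non-CM `W` with `ρ̄_{W,2}` onto but `ρ_{W,2^∞}` not onto (Dokchitser–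
  Dokchitser: `√Δ ∈ ℚ(μ_{2^∞})` or `j = −4t³(t+8)`); by MEMO-7 Thm. D-S₃ it follows from Iwasawa's
  `μ₂ = 0` for the cyclotomic `ℤ₂`-extension of the `S₃`-cubic field `ℚ(P)` (certifiable per class).
  Nothing asserted.
* `exists_isIsogenous_mainConjectureLowerDivisibilityAtTwoOrd_of_binder` — binder + PRINT (Kato 17.4 (1)(2)
  at `2`, `∀`-form `h17`) ⇒ the typed item `X5.O1.MainConjectureLowerDivisibilityAtTwoOrd W′` at the
  Kato-optimal member (through the landed `O1.mainConjectureLowerDivisibilityAtTwoOrd_of_katoMuPartAtTwo`).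
* `stub_nonsurj_iso_of_binder` — **the registered signature of `stub_nonsurj_iso` VERBATIM** from
  {binder, `h17`}: the stub is a kernel theorem modulo ONE displayed memo binder and ONE print fact.
* `goodOrd_two_of_isIsogenous`, `twoAdicSurjective_imp_hasSurjectiveModNGaloisRep_two` — bookkeeping.
* `mainConjectureLowerDivisibilityAtTwoOrd_self_or_residue_of_binders` — at a curve with `ρ̄₂` onto:
  GEN 8's binder `KatoIntAtGoodOrdSurjectiveTwo` covers `ρ_{2^∞}` onto, the residue binder the rest.

HONEST FRAMING (cell `bsd-2adic`): memo-grade binders DISPLAYED by name, not Literature facts and not kernel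
theorems; rows through these doors are NO-OFFER until the binder is print or kernel. PARTITION: X5@2 good-ord
(B1·O1; 611 classes; habitat of the first binder = the 169 `E[2]`-reducible + 2 `C₃` classes, of the second
= the 4 DD12 classes) × p = 2 — types-the-object-of; closes none; nothing booked.
-/

set_option autoImplicit false
set_option linter.dupNamespace false

noncomputable section

open scoped Classical MatrixGroups ModularForm

open CongruenceSubgroup WeierstrassCurve Literature.NumberTheory.EllipticCurves
  Literature.NumberTheory.EllipticCurves.ModularForms
  Literature.NumberTheory.EllipticCurves.Rank1Residual
  Literature.NumberTheory.EllipticCurves.Rank1Residual.Typed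
  Summit.BirchSwinnertonDyer.Rank1Residual.X5
  Summit.BirchSwinnertonDyer.Rank1Residual.X2.IsogenyLineTypeGoodOrdinary
  Summit.BirchSwinnertonDyer.BirchSwinnertonDyer.Theorems.OrdKatoIntAtTwo

namespace Summit.BirchSwinnertonDyer.BirchSwinnertonDyer.Theorems.OrdKatoOptimalAtTwo

/-- [crux, CELL-MEMO] **MEMO-7 Theorem D / D-C₃ (cell `bsd-2adic`, seat `bsd-2adic-ord` GEN 10), in the
tree's `μ`-part currency.** For every non-CM globally minimal elliptic `W/ℚ`, good ordinary at `2`, with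
`ρ̄_{W,2}` NOT surjective, there is a `ℚ`-isogenous globally minimal `W′` (the Kato-optimal member:
`T₂E′(−1) ≃ V_{ℤ₂}(f)`, Kato's lattice of (8.3)) such that (a) `O1.KatoMuPartAtTwo W′` — for every
cyclotomic datum, the newform `f`, every `ϖ` with `ϖ·Ω_{W′} = Ω⁺_f`, every Selmer dual datum `D` and every
`L₀ ∈ Λ` with `ι L₀ = ϖ·L₂(f,α)`: `2^{μ(D.X)} ∣ L₀` — and (b) such an `L₀ ∈ Λ` exists (Néron
integrality at `W′`). Memo-grade proof: ES-free `Λ`-adic sequence `0 → 𝐇¹(T) → B → X → Y → 0` at `E′`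
(Kato Thm. 12.4, 12.6, 16.2, 16.6 (2), 17.4 (1)(2), 17.5, 17.9, 17.11 at `p = 2`, parity-free as printed;
Greenberg Props. 2.2/2.4 at `2`; Bloch–Kato 3.8; Poitou–Tate), giving
`μ(X(E′)) + ord₂ c_∞(E′) ≤ μ(L₂(E′,T)) + μ(Y^{rel}(E′))`, and `μ(Y) = μ(Y^{rel}) = 0` for every
`E[2]`-reducible or `C₃` curve from Weber (odd class numbers of `ℚ(ζ_{2^m})`, `ℚ(ζ_{2^m})⁺`, narrow
included) and Ferrero–Washington for the abelian field `ℚ(E[2], i)`. NOT in print at `p = 2`; the `p`-odd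
analogue is Wuthrich's theorem. Nothing asserted.
[cite: Wuthrich2014, Thm. 16, Lemma 14, Prop. 15, Lemma 17 and the proof of Thm. 16 at E• (pp. 396–398) (p odd; shape only)]
[cite: Kato2004Asterisque, Thm. 12.4, 12.6 (pp. 221–222), Thm. 16.6 (2), 17.4 (1)(2) (p. 273), 17.5, Prop. 17.11]
[cite: GreenbergLNM1716, Props. 2.2, 2.4 (p. 18 «This argument works even for p = 2») and p. 170 (μ_E = m_E)]
[cite: Washington1997, Thm. 7.15 (Ferrero–Washington), Thm. 10.4 (Weber), §13.3] -/
@[conjecture] def KatoMuPartAtOptimalMemberOfNotSurjectiveTwo : Prop :=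
  ∀ (W : WeierstrassCurve ℚ) [W.IsElliptic] [W.IsGloballyMinimal],
    ¬ W.HasCM → GoodOrd W 2 → ¬ W.HasSurjectiveModNGaloisRep 2 →
    ∃ (W' : WeierstrassCurve ℚ) (_ : W'.IsElliptic) (_ : W'.IsGloballyMinimal),
      WeierstrassCurve.IsIsogenous W W' ∧ O1.KatoMuPartAtTwo W' ∧
      ∀ [NeZero (W'.conductorNorm ℤ)] (f : CuspForm (Gamma0 (W'.conductorNorm ℤ)) 2),
        IsNewformOf W' f → ∀ ϖ : ℚ, (ϖ : ℝ) * W'.realPeriodRat = plusPeriod f →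
          ∃ L₀ : IwasawaAlgebra 2, iwasawaToPowerSeries 2 L₀ =
            PowerSeries.C (ϖ : ℚ_[2]) * padicLFunction f (unitRoot W' 2 : ℚ_[2])

/-- [crux, OPEN] **The `∀`-residue of crux `OrdKatoHalfAtTwoIso` after MEMO-7**: the typed item AT `W`
for every non-CM globally minimal `W`, good ordinary at `2`, with `ρ̄_{W,2}` onto and `ρ_{W,2^∞}` NOT onto
(Dokchitser–Dokchitser: `√Δ_W ∈ ℚ(μ_{2^∞})` or `j_W = −4t³(t+8)`; 4 census classes). By MEMO-7
Thm. D-S₃ (= adjoint-selmer-patching Thms. A, C, 6.9 + Prop. 8.1, read for `ρ̄ ≅ S₃`) it follows from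
Iwasawa's conjecture `μ₂ = 0` for the cyclotomic `ℤ₂`-extension of the `S₃`-cubic field `ℚ(P)`, decidable
per field by a ray-class-group stabilisation certificate. OPEN as a class statement; nothing asserted.
[cite: DokchitserDokchitserMathZ2012, Theorem (p. 961)] [cite: Washington1997, §13.3 (Iwasawa–Fukuda stabilisation)] -/
@[conjecture] def OrdKatoHalfDD12ResidueTwo : Prop :=
  ∀ (W : WeierstrassCurve ℚ) [W.IsElliptic] [W.IsGloballyMinimal],
    ¬ W.HasCM → GoodOrd W 2 → W.HasSurjectiveModNGaloisRep 2 → ¬ O1.TwoAdicSurjective W →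
    O1.MainConjectureLowerDivisibilityAtTwoOrd W

/-- `KatoMuPartAtOptimalMemberOfNotSurjectiveTwo` unfolds to its displayed body. [folklore] -/
theorem katoMuPartAtOptimalMemberOfNotSurjectiveTwo_iff : KatoMuPartAtOptimalMemberOfNotSurjectiveTwo ↔
    ∀ (W : WeierstrassCurve ℚ) [W.IsElliptic] [W.IsGloballyMinimal],
      ¬ W.HasCM → GoodOrd W 2 → ¬ W.HasSurjectiveModNGaloisRep 2 →
      ∃ (W' : WeierstrassCurve ℚ) (_ : W'.IsElliptic) (_ : W'.IsGloballyMinimal),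
        WeierstrassCurve.IsIsogenous W W' ∧ O1.KatoMuPartAtTwo W' ∧
        ∀ [NeZero (W'.conductorNorm ℤ)] (f : CuspForm (Gamma0 (W'.conductorNorm ℤ)) 2),
          IsNewformOf W' f → ∀ ϖ : ℚ, (ϖ : ℝ) * W'.realPeriodRat = plusPeriod f →
            ∃ L₀ : IwasawaAlgebra 2, iwasawaToPowerSeries 2 L₀ =
              PowerSeries.C (ϖ : ℚ_[2]) * padicLFunction f (unitRoot W' 2 : ℚ_[2]) :=
  Iff.rfl

/-- `OrdKatoHalfDD12ResidueTwo` unfolds to its displayed body. [folklore] -/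
theorem ordKatoHalfDD12ResidueTwo_iff : OrdKatoHalfDD12ResidueTwo ↔
    ∀ (W : WeierstrassCurve ℚ) [W.IsElliptic] [W.IsGloballyMinimal],
      ¬ W.HasCM → GoodOrd W 2 → W.HasSurjectiveModNGaloisRep 2 → ¬ O1.TwoAdicSurjective W →
      O1.MainConjectureLowerDivisibilityAtTwoOrd W :=
  Iff.rfl

variable (W : WeierstrassCurve ℚ) [W.IsElliptic] [W.IsGloballyMinimal]

/-- Good ORDINARY reduction at `2` passes along a `ℚ`-isogeny (good reduction: Serre–Tate/the tree's
`IsIsogenous.hasGoodReductionAtPrime_iff`; `a₂(E) = a₂(E′)`: Faltings). Re-export for the doors below.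
[cite: Faltings1983Endlichkeit, §5 Korollar 2] -/
theorem goodOrd_two_of_isIsogenous {W' : WeierstrassCurve ℚ} [W'.IsElliptic] [W'.IsGloballyMinimal]
    (hiso : IsIsogenous W W') (hgo : GoodOrd W 2) : GoodOrd W' 2 :=
  ⟨hasGoodReductionAtPrime_of_isIsogenous hiso hgo.1, not_dvd_frobeniusTrace_of_isIsogenous hiso hgo.1 hgo.2⟩

omit [W.IsElliptic] [W.IsGloballyMinimal] in
/-- `ρ_{W,2^∞}` onto (surjective modulo every `2ⁿ`, `n ≥ 1`) ⇒ `ρ̄_{W,2}` onto (`n = 1`). [folklore] -/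
theorem twoAdicSurjective_imp_hasSurjectiveModNGaloisRep_two (h : O1.TwoAdicSurjective W) :
    W.HasSurjectiveModNGaloisRep 2 := by
  simpa using h 1 one_pos

/-- **Binder + PRINT ⇒ the typed item at the Kato-optimal member.** From the memo binder and Kato's
Thm. 17.4 (1)(2) at `2` in its `∀`-form (`h17`, PRINT, parity-free; the route's `OrdPublishedInputsAtTwo`
third component): for non-CM good-ordinary `W` with `ρ̄_{W,2}` not onto there is an isogenous globally
minimal `W′` with `X5.O1.MainConjectureLowerDivisibilityAtTwoOrd W′` — through the landed
`O1.mainConjectureLowerDivisibilityAtTwoOrd_of_katoMuPartAtTwo` (`μ`-part + integrality + 17.4 (1)(2) ⇒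
item). [cite: Kato2004Asterisque, Thm. 17.4 (1)(2) (p. 273)] -/
theorem exists_isIsogenous_mainConjectureLowerDivisibilityAtTwoOrd_of_binder
    (hB : KatoMuPartAtOptimalMemberOfNotSurjectiveTwo)
    (h17 : ∀ (V : WeierstrassCurve ℚ) [V.IsElliptic] [V.IsGloballyMinimal] [NeZero (V.conductorNorm ℤ)]
      (f : CuspForm (Gamma0 (V.conductorNorm ℤ)) 2), kato_divisibility_allPrimes V 2 (f := f))
    (hcm : ¬ W.HasCM) (hgo : GoodOrd W 2) (him : ¬ W.HasSurjectiveModNGaloisRep 2) :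
    ∃ (W' : WeierstrassCurve ℚ) (_ : W'.IsElliptic) (_ : W'.IsGloballyMinimal),
      IsIsogenous W W' ∧ O1.MainConjectureLowerDivisibilityAtTwoOrd W' := by
  obtain ⟨W', _, _, hiso, hμ, hint⟩ := hB W hcm hgo him
  exact ⟨W', ‹_›, ‹_›, hiso,
    O1.mainConjectureLowerDivisibilityAtTwoOrd_of_katoMuPartAtTwo W' (fun f => h17 W' f)
      (fun f hf ϖ hϖ => hint f hf ϖ hϖ) hμ⟩

omit W [W.IsElliptic] [W.IsGloballyMinimal] in
/-- **The registered stub `stub_nonsurj_iso` of crux `OrdKatoHalfAtTwoIso` (skeleton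
`Cruxes/OrdKatoHalfAtTwoIso/Lines/birth.lean`, item stmt-BirchSwinnertonDyer-19573), VERBATIM, modulo the
memo binder and `h17`** (the stub's `W.analyticRank = 0` is not used). [cite: Kato2004Asterisque, Thm. 17.4 (1)(2) (p. 273)] -/
theorem stub_nonsurj_iso_of_binder (hB : KatoMuPartAtOptimalMemberOfNotSurjectiveTwo)
    (h17 : ∀ (V : WeierstrassCurve ℚ) [V.IsElliptic] [V.IsGloballyMinimal] [NeZero (V.conductorNorm ℤ)]
      (f : CuspForm (Gamma0 (V.conductorNorm ℤ)) 2), kato_divisibility_allPrimes V 2 (f := f)) :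
    ∀ (W : WeierstrassCurve ℚ) [W.IsElliptic] [W.IsGloballyMinimal], ¬ W.HasCM → W.analyticRank = 0 →
      GoodOrd W 2 → ¬ W.HasSurjectiveModNGaloisRep 2 →
      ∃ (W' : WeierstrassCurve ℚ) (_ : W'.IsElliptic) (_ : W'.IsGloballyMinimal), WeierstrassCurve.IsIsogenous W W' ∧
        Summit.BirchSwinnertonDyer.Rank1Residual.X5.O1.MainConjectureLowerDivisibilityAtTwoOrd W' :=
  fun W _ _ hcm _ hgo him =>
    exists_isIsogenous_mainConjectureLowerDivisibilityAtTwoOrd_of_binder W hB h17 hcm hgo him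

/-- **At a curve with `ρ̄_{W,2}` onto**: GEN 8's binder `KatoIntAtGoodOrdSurjectiveTwo` (W_K2 / MEMO-5 /
MEMO-6; RESERVE/MEMO tier) gives the item when `ρ_{W,2^∞}` is onto, and the residue binder
`OrdKatoHalfDD12ResidueTwo` (OPEN) when it is not — the two `@[conjecture]` constants that, with
`KatoMuPartAtOptimalMemberOfNotSurjectiveTwo`, exhaust the crux (MEMO-7 Cor. D3). [folklore] -/
theorem mainConjectureLowerDivisibilityAtTwoOrd_self_or_residue_of_binders
    (hB8 : KatoIntAtGoodOrdSurjectiveTwo) (hDD : OrdKatoHalfDD12ResidueTwo)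
    (hcm : ¬ W.HasCM) (hgo : GoodOrd W 2) (him : W.HasSurjectiveModNGaloisRep 2) :
    O1.MainConjectureLowerDivisibilityAtTwoOrd W := by
  by_cases hinf : O1.TwoAdicSurjective W
  · exact hB8 W hgo hinf
  · exact hDD W hcm hgo him hinf

/-- **The `∃`-member form at EVERY non-CM good-ordinary curve from the three binders + `h17`** (the body
of the crux `OrdKatoHalfAtTwoIso` without its `analyticRank = 0` hypothesis; the Theses-importing ledger
file states it BY NAME). [cite: Kato2004Asterisque, Thm. 17.4 (1)(2) (p. 273)] -/
theorem exists_isIsogenous_mainConjectureLowerDivisibilityAtTwoOrd_of_binders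
    (hB7 : KatoMuPartAtOptimalMemberOfNotSurjectiveTwo) (hB8 : KatoIntAtGoodOrdSurjectiveTwo)
    (hDD : OrdKatoHalfDD12ResidueTwo)
    (h17 : ∀ (V : WeierstrassCurve ℚ) [V.IsElliptic] [V.IsGloballyMinimal] [NeZero (V.conductorNorm ℤ)]
      (f : CuspForm (Gamma0 (V.conductorNorm ℤ)) 2), kato_divisibility_allPrimes V 2 (f := f))
    (hcm : ¬ W.HasCM) (hgo : GoodOrd W 2) :
    ∃ (W' : WeierstrassCurve ℚ) (_ : W'.IsElliptic) (_ : W'.IsGloballyMinimal),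
      IsIsogenous W W' ∧ O1.MainConjectureLowerDivisibilityAtTwoOrd W' := by
  by_cases him : W.HasSurjectiveModNGaloisRep 2
  · exact ⟨W, ‹_›, ‹_›, isIsogenous_self W,
      mainConjectureLowerDivisibilityAtTwoOrd_self_or_residue_of_binders W hB8 hDD hcm hgo him⟩
  · exact exists_isIsogenous_mainConjectureLowerDivisibilityAtTwoOrd_of_binder W hB7 h17 hcm hgo him

end Summit.BirchSwinnertonDyer.BirchSwinnertonDyer.Theorems.OrdKatoOptimalAtTwo

end
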